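/-
Copyright: H21 programme, solo seat `solo-RiemannHypothesis-informed` (session 6).
-/
import Summits.RiemannHypothesis.RiemannHypothesis.Theorems.SoloInformedCombPair
import Summits.RiemannHypothesis.RiemannHypothesis.Theorems.SoloInformedCombZeros
import Literature.NumberTheory.LFunctions.ZetaZerosReflection
import Summits.RiemannHypothesis.RiemannHypothesis.Theorems.SoloInformedFenceInvisibility

/-!
# Weil positivity bounds the exponential sum of the core zeros (solo-informed, T39g)

Let `P` be a finite set of zeros of `ζ` with `Re ρ > ½` and `|Im ρ - γ₀| < R`, `R = π(J+K) ≤ |γ₀|`,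
such that every off-line zero of the zone `|Im ρ - γ₀| < R` is in `P` or is the reflection
`1 - ρ̄` of a member of `P`.  Write `λ_ρ = ρ - ½ - iγ₀`, `Φ_ρ = Φ_J(λ_ρ)` and

`U(τ) = ∑_{ρ ∈ P} m(ρ) Φ_ρ² e^{λ_ρ τ}`,  `S = ∑_{ρ ∈ P} m(ρ) |Φ_ρ|²`.

**T39g** (`norm_combExpSum_le`).  If `weilGroundEnergy a ≥ 0`, `a ≥ 5/2`, and the far-zone
condition `e^{a} (2L_q/(πK)^{q-2})² ≤ C_χ²` holds, then for every `τ ∈ [2, 2a-2]`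

`|U(τ)| ≤ 20π A₁ C_χ² (2J+1) log(|γ₀| + πJ + 2)`.

Proof: test Weil positivity (`weilGroundEnergy_le_of_pairs`) with the bilinear comb test
`g = (φ_J(·-t_A) + c φ_J(·-s_B)) e^{-iγ₀·}`, `t_A = a-1`, `t_A - s_B = τ`, `c = -U/|U|`, on the
reflection-closed set `P ⊔ (1 - P̄)` (any `a ≥ 2`); the net pair identity turns `B - ½∑ defects` into
`Maj + ∑_P 2m Re[Φ²((1+|c|²) + c̄e^{λτ} + ce^{-λτ})] ≤ Maj + 6S - 2|U|`, and both the majorant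
`Maj` (comb-weight majorant, `SoloInformedCombZeros`) and `S` are `O(C_χ² A₁ (2J+1) log)`.
-/

noncomputable section

open Real MeasureTheory Filter Complex Set Literature.NumberTheory.LFunctions
open scoped Topology ContDiff ComplexConjugate

namespace Summit.RiemannHypothesis.RiemannHypothesis.Theorems

open Companion

namespace Companion

/-- Reflection of zeros across the critical line: `ζ(ρ) = 0`, `0 < Re ρ < 1` ⇒ `ζ(1 - ρ̄) = 0`. -/
theorem riemannZeta_one_sub_conj_eq_zero {ρ : ℂ} (hz : riemannZeta ρ = 0) (h0 : 0 < ρ.re)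
    (h1 : ρ.re < 1) : riemannZeta (1 - conj ρ) = 0 := by
  have hne : ρ ≠ 1 := ne_one_of_riemannZeta_eq_zero hz
  have hne' : (1 - conj ρ : ℂ) ≠ 1 := by
    intro h; have := congrArg Complex.re h; simp at this; linarith
  have hm := (riemannZetaZeroOrder_pos_iff hne).mpr hz
  rw [← riemannZetaZeroOrder_one_sub_conj h0 h1] at hm
  exact (riemannZetaZeroOrder_pos_iff hne').mp hm

/-- `Re(c̄ U) = -|U|` for `c = -U/|U|` (also when `U = 0`). -/
theorem re_conj_phase_mul (U : ℂ) : (conj (-U / (‖U‖ : ℂ)) * U).re = -‖U‖ := by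
  rcases eq_or_ne U 0 with h | h
  · simp [h]
  · have hn : (‖U‖ : ℂ) ≠ 0 := by exact_mod_cast (norm_ne_zero_iff.mpr h)
    have e : conj (-U / (‖U‖ : ℂ)) * U = -(‖U‖ : ℂ) := by
      rw [map_div₀, map_neg, Complex.conj_ofReal, div_mul_eq_mul_div, neg_mul,
        ← Complex.normSq_eq_conj_mul_self, Complex.normSq_eq_norm_sq]
      push_cast
      field_simp
    rw [e, neg_re, Complex.ofReal_re]

/-- `|c| ≤ 1` for `c = -U/|U|`. -/
theorem norm_phase_le (U : ℂ) : ‖-U / (‖U‖ : ℂ)‖ ≤ 1 := by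
  rcases eq_or_ne U 0 with h | h
  · simp [h]
  · rw [norm_div, norm_neg, Complex.norm_real, Real.norm_eq_abs, abs_norm, div_self]
    exact norm_ne_zero_iff.mpr h

end Companion

section

variable {J K q : ℕ} {c : ℂ} {tA sB γ₀ a : ℝ}

/-- **Comb-weight majorant of the bilinear comb test**: for `|c| ≤ 1`, `|t_A|, |s_B| ≤ a - 1` and
the far-zone condition `e^{a}(2L_q/(πK)^{q-2})² ≤ C_χ²`, every point `ρ` of the strip which is
either on the critical line or at vertical distance `≥ π(J+K)` from `γ₀` has
`|ĝ(ρ)|² ≤ 8π C_χ² W_J(Im ρ - γ₀)`. -/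
theorem norm_sq_weilMellin_combPair_le_combWeight (hq : 2 ≤ q) (hK : 1 ≤ K) (hc : ‖c‖ ≤ 1)
    (ha : 1 ≤ a) (htA : |tA| ≤ a - 1) (hsB : |sB| ≤ a - 1)
    (hK2 : Real.exp a * (2 * combL q / (π * K) ^ (q - 2)) ^ 2 ≤ combC ^ 2) {ρ : ℂ}
    (h0 : 0 ≤ ρ.re) (h1 : ρ.re ≤ 1) (hρ : ρ.re = 1 / 2 ∨ π * (J + K) ≤ |ρ.im - γ₀|) :
    ‖weilMellin (combPair J c tA sB γ₀) ρ‖ ^ 2 ≤ 8 * π * combC ^ 2 * combWeight J (ρ.im - γ₀) := by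
  set μ : ℂ := ρ - 1 / 2 - γ₀ * I with hμ
  have hre' : μ.re = ρ.re - 1 / 2 := by simp [hμ]
  have him' : μ.im = ρ.im - γ₀ := by simp [hμ]
  have hre : |μ.re| ≤ 1 / 2 := by rw [hre', abs_le]; constructor <;> linarith
  have hW0 := combWeight_pos J (ρ.im - γ₀)
  have hW1 := combWeight_le J (ρ.im - γ₀)
  have hC := combC_nonneg
  rcases hρ with hline | hfar
  · have h := norm_sq_weilMellin_combPair_le_critical (J := J) (γ₀ := γ₀) hc htA hsB hline
    have hΦ : ‖combXform J μ‖ ≤ combC * combWeight J (ρ.im - γ₀) := by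
      rw [← him']; exact norm_combXform_le J hre
    have hΦ0 := norm_nonneg (combXform J μ)
    calc ‖weilMellin (combPair J c tA sB γ₀) ρ‖ ^ 2 ≤ 4 * ‖combXform J μ‖ ^ 2 := h
      _ ≤ 4 * (combC * combWeight J (ρ.im - γ₀)) ^ 2 := by gcongr
      _ = 4 * combC ^ 2 * combWeight J (ρ.im - γ₀) * combWeight J (ρ.im - γ₀) := by ring
      _ ≤ 4 * combC ^ 2 * combWeight J (ρ.im - γ₀) * (2 * π) := by gcongr
      _ = 8 * π * combC ^ 2 * combWeight J (ρ.im - γ₀) := by ring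
  · have h := norm_sq_weilMellin_combPair_le_strip (J := J) (γ₀ := γ₀) hc ha htA hsB h0 h1
    set D : ℝ := 2 * combL q / (π * K) ^ (q - 2) with hD
    have hD0 : 0 ≤ D := by rw [hD]; exact div_nonneg (by linarith [combL_nonneg q]) (by positivity)
    have hΦ : ‖combXform J μ‖ ≤ D * combWeight J (ρ.im - γ₀) := by
      rw [← him']; exact norm_combXform_le_far hq hK hre (by rwa [him'])
    have hΦ0 := norm_nonneg (combXform J μ)
    have hexp : Real.exp (a - 1) ≤ Real.exp a := Real.exp_le_exp.mpr (by linarith)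
    have hexp0 := Real.exp_pos (a - 1)
    calc ‖weilMellin (combPair J c tA sB γ₀) ρ‖ ^ 2
        ≤ 4 * Real.exp (a - 1) * ‖combXform J μ‖ ^ 2 := h
      _ ≤ 4 * Real.exp (a - 1) * (D * combWeight J (ρ.im - γ₀)) ^ 2 := by gcongr
      _ = 4 * (Real.exp (a - 1) * D ^ 2) * combWeight J (ρ.im - γ₀) *
            combWeight J (ρ.im - γ₀) := by ring
      _ ≤ 4 * (Real.exp a * D ^ 2) * combWeight J (ρ.im - γ₀) * (2 * π) := by
          gcongr
      _ ≤ 4 * combC ^ 2 * combWeight J (ρ.im - γ₀) * (2 * π) := by gcongr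
      _ = 8 * π * combC ^ 2 * combWeight J (ρ.im - γ₀) := by ring

/-- **The zero sum of the bilinear comb test**: under the hypotheses of
`norm_sq_weilMellin_combPair_le_combWeight`, if every zero `ρ` of the zone `|Im ρ - γ₀| < π(J+K)`
off the critical line lies in the finite set `S`, then for all `T`
`Z_T(g) ≤ 16π A₁ C_χ² (2J+1) log(|γ₀| + πJ + 2) + ∑_{ρ ∈ S} m(ρ)|ĝ(ρ)|²`. -/
theorem zeroSum_combPair_le (hq : 2 ≤ q) (hK : 1 ≤ K) (hc : ‖c‖ ≤ 1) (ha : 1 ≤ a)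
    (htA : |tA| ≤ a - 1) (hsB : |sB| ≤ a - 1)
    (hK2 : Real.exp a * (2 * combL q / (π * K) ^ (q - 2)) ^ 2 ≤ combC ^ 2) (S : Finset ℂ)
    (hS : ∀ ρ ∈ S, riemannZeta ρ = 0)
    (hzone : ∀ ρ : ℂ, riemannZeta ρ = 0 → 0 ≤ ρ.re → ρ.re ≤ 1 → ρ.re ≠ 1 / 2 →
      |ρ.im - γ₀| < π * (J + K) → ρ ∈ S) (T : ℝ) :
    ∑ᶠ ρ ∈ weilZeroIndex T, (riemannZetaZeroOrder ρ : ℝ) *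
        ‖weilMellin (combPair J c tA sB γ₀) ρ‖ ^ 2 ≤
      16 * π * zetaDensityConst * combC ^ 2 * (2 * J + 1) * Real.log (|γ₀| + π * J + 2) +
        ∑ ρ ∈ S, (riemannZetaZeroOrder ρ : ℝ) * ‖weilMellin (combPair J c tA sB γ₀) ρ‖ ^ 2 := by
  classical
  set g := combPair J c tA sB γ₀
  set F : ℂ → ℝ := fun ρ ↦ if riemannZeta ρ = 0 then ‖weilMellin g ρ‖ ^ 2 else 0 with hF
  have hF0 : ∀ ρ, 0 ≤ F ρ := fun ρ ↦ by
    by_cases hz : riemannZeta ρ = 0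
    · simp only [hF, hz, if_true]; positivity
    · simp only [hF, hz, if_false]; exact le_rfl
  have hM : (0 : ℝ) ≤ 8 * π * combC ^ 2 := by positivity
  have hS1 : ∀ ρ ∈ S, ρ ≠ 1 := fun ρ hρ ↦ ne_one_of_riemannZeta_eq_zero (hS ρ hρ)
  have hmaj : ∀ ρ : ℂ, 0 ≤ ρ.re → ρ.re ≤ 1 → ρ ∉ S →
      F ρ ≤ 8 * π * combC ^ 2 * combWeight J (ρ.im - γ₀) := by
    intro ρ h0 h1 hρS
    by_cases hz : riemannZeta ρ = 0
    · simp only [hF, hz, if_true]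
      refine norm_sq_weilMellin_combPair_le_combWeight hq hK hc ha htA hsB hK2 h0 h1 ?_
      by_cases hline : ρ.re = 1 / 2
      · exact Or.inl hline
      · right
        by_contra hnear
        exact hρS (hzone ρ hz h0 h1 hline (not_le.mp hnear))
    · simp only [hF, hz, if_false]
      exact mul_nonneg hM (combWeight_pos J _).le
  have h := finsum_weilZeroIndex_le_of_comb_bound F γ₀ J S hM hF0 hS1 hmaj T
  have hcongr : ∑ᶠ ρ ∈ weilZeroIndex T, (riemannZetaZeroOrder ρ : ℝ) * F ρ =
      ∑ᶠ ρ ∈ weilZeroIndex T, (riemannZetaZeroOrder ρ : ℝ) * ‖weilMellin g ρ‖ ^ 2 :=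
    finsum_mem_congr rfl fun ρ hρ ↦ by
      have hz : riemannZeta ρ = 0 := hρ.1
      simp only [hF, hz, if_true]
  have hcongrS : ∑ ρ ∈ S, (riemannZetaZeroOrder ρ : ℝ) * F ρ =
      ∑ ρ ∈ S, (riemannZetaZeroOrder ρ : ℝ) * ‖weilMellin g ρ‖ ^ 2 :=
    Finset.sum_congr rfl fun ρ hρ ↦ by simp only [hF, hS ρ hρ, if_true]
  rw [hcongr, hcongrS] at h
  refine h.trans (le_of_eq ?_)
  ring

end

/-- **T39g′.**  `S = ∑_{ρ∈P} m(ρ)|Φ_J(λ_ρ)|² ≤ 4π A₁ C_χ² (2J+1) log(|γ₀| + πJ + 2)` for every finite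
set `P` of zeros of `ζ` in the strip off the real axis. -/
theorem sum_norm_sq_combXform_le (γ₀ : ℝ) (J : ℕ) (P : Finset ℂ)
    (hP : ∀ ρ ∈ P, riemannZeta ρ = 0 ∧ 0 ≤ ρ.re ∧ ρ.re ≤ 1 ∧ ρ.im ≠ 0) :
    ∑ ρ ∈ P, (riemannZetaZeroOrder ρ : ℝ) * ‖combXform J (ρ - 1 / 2 - γ₀ * I)‖ ^ 2 ≤
      4 * π * zetaDensityConst * combC ^ 2 * (2 * J + 1) * Real.log (|γ₀| + π * J + 2) := by
  have h := sum_zeros_combWeight_le γ₀ J P hP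
  have hC := combC_nonneg
  have hterm : ∀ ρ ∈ P, (riemannZetaZeroOrder ρ : ℝ) * ‖combXform J (ρ - 1 / 2 - γ₀ * I)‖ ^ 2 ≤
      2 * π * combC ^ 2 * ((riemannZetaZeroOrder ρ : ℝ) * combWeight J (ρ.im - γ₀)) := by
    intro ρ hρ
    obtain ⟨hz, h0, h1, -⟩ := hP ρ hρ
    have hm : (0 : ℝ) ≤ riemannZetaZeroOrder ρ := riemannZetaZeroOrder_nonneg_of_zero hz
    have hre : |(ρ - 1 / 2 - γ₀ * I).re| ≤ 1 / 2 := by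
      rw [show (ρ - 1 / 2 - γ₀ * I).re = ρ.re - 1 / 2 by simp, abs_le]
      constructor <;> linarith
    have hΦ := norm_combXform_le J hre
    rw [show (ρ - 1 / 2 - γ₀ * I).im = ρ.im - γ₀ by simp] at hΦ
    have hW0 := combWeight_pos J (ρ.im - γ₀)
    have hW1 := combWeight_le J (ρ.im - γ₀)
    have hΦ0 := norm_nonneg (combXform J (ρ - 1 / 2 - γ₀ * I))
    calc (riemannZetaZeroOrder ρ : ℝ) * ‖combXform J (ρ - 1 / 2 - γ₀ * I)‖ ^ 2
        ≤ (riemannZetaZeroOrder ρ : ℝ) * (combC * combWeight J (ρ.im - γ₀)) ^ 2 := by gcongr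
      _ = (riemannZetaZeroOrder ρ : ℝ) * combC ^ 2 * combWeight J (ρ.im - γ₀) *
            combWeight J (ρ.im - γ₀) := by ring
      _ ≤ (riemannZetaZeroOrder ρ : ℝ) * combC ^ 2 * combWeight J (ρ.im - γ₀) * (2 * π) := by
          gcongr
      _ = _ := by ring
  refine (Finset.sum_le_sum hterm).trans ?_
  rw [← Finset.mul_sum]
  have : 0 ≤ 2 * π * combC ^ 2 := by positivity
  nlinarith

/-- **T39g (Weil positivity bounds the core exponential sum).**  See the module docstring. -/
theorem norm_combExpSum_le {J K q : ℕ} (hq : 2 ≤ q) (hK : 1 ≤ K) {a γ₀ : ℝ} (ha : 2 ≤ a)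
    (hγ : π * (J + K) ≤ |γ₀|)
    (hK2 : Real.exp a * (2 * combL q / (π * K) ^ (q - 2)) ^ 2 ≤ combC ^ 2) (P : Finset ℂ)
    (hP : ∀ ρ ∈ P, riemannZeta ρ = 0 ∧ 1 / 2 < ρ.re ∧ |ρ.im - γ₀| < π * (J + K))
    (hcomp : ∀ ρ : ℂ, riemannZeta ρ = 0 → 0 ≤ ρ.re → ρ.re ≤ 1 → ρ.re ≠ 1 / 2 →
      |ρ.im - γ₀| < π * (J + K) → ρ ∈ P ∨ 1 - conj ρ ∈ P)
    (hE : 0 ≤ weilGroundEnergy a) {τ : ℝ} (hτ : 2 ≤ τ) (hτa : τ ≤ 2 * a - 2) :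
    ‖∑ ρ ∈ P, (riemannZetaZeroOrder ρ : ℝ) *
        (combXform J (ρ - 1 / 2 - γ₀ * I) ^ 2 * cexp ((ρ - 1 / 2 - γ₀ * I) * τ))‖ ≤
      20 * π * zetaDensityConst * combC ^ 2 * (2 * J + 1) * Real.log (|γ₀| + π * J + 2) := by
  classical
  -- notation
  set A₁ : ℝ := zetaDensityConst
  set L : ℝ := Real.log (|γ₀| + π * J + 2) with hL
  set Λ : ℂ → ℂ := fun ρ ↦ ρ - 1 / 2 - γ₀ * I with hΛ
  set Φ : ℂ → ℂ := fun ρ ↦ combXform J (Λ ρ) with hΦ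
  set m : ℂ → ℝ := fun ρ ↦ (riemannZetaZeroOrder ρ : ℝ) with hm
  set U : ℂ := ∑ ρ ∈ P, (m ρ : ℂ) * (Φ ρ ^ 2 * cexp (Λ ρ * τ)) with hU
  set Sq : ℝ := ∑ ρ ∈ P, m ρ * ‖Φ ρ‖ ^ 2 with hSq
  change ‖U‖ ≤ 20 * π * A₁ * combC ^ 2 * (2 * J + 1) * L
  have hL0 : 0 ≤ L := Real.log_nonneg (by linarith [abs_nonneg γ₀, Real.pi_pos.le,
    (by positivity : (0 : ℝ) ≤ π * J)])
  -- the test function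
  set c : ℂ := -U / (‖U‖ : ℂ) with hc_def
  have hc : ‖c‖ ≤ 1 := norm_phase_le U
  set tA : ℝ := a - 1 with htA_def
  set sB : ℝ := a - 1 - τ with hsB_def
  have ha1 : 1 ≤ a := by linarith
  have htA : |tA| ≤ a - 1 := by rw [htA_def, abs_of_nonneg (by linarith)]
  have hsB : |sB| ≤ a - 1 := by rw [hsB_def, abs_le]; constructor <;> linarith
  have hτeq : tA - sB = τ := by rw [htA_def, hsB_def]; ring
  set g := combPair J c tA sB γ₀ with hg_def
  have hg : IsWeilTest g := isWeilTest_combPair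
  have hgs : tsupport g ⊆ Icc (-a) a := tsupport_combPair_subset htA hsB
  have hpos : 0 < ∫ t, ‖g t‖ ^ 2 :=
    integral_norm_sq_combPair_pos (by rw [hτeq, abs_of_nonneg (by linarith)]; linarith)
  -- facts about the members of `P`
  have hPf : ∀ ρ ∈ P, riemannZeta ρ = 0 ∧ 1 / 2 < ρ.re ∧ ρ.re < 1 ∧ ρ.im ≠ 0 ∧
      riemannZeta (1 - conj ρ) = 0 ∧ riemannZetaZeroOrder (1 - conj ρ) = riemannZetaZeroOrder ρ := by
    intro ρ hρ
    obtain ⟨hz, hre, him⟩ := hP ρ hρ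
    have h1 := re_lt_one_of_riemannZeta_eq_zero hz
    refine ⟨hz, hre, h1, ?_, riemannZeta_one_sub_conj_eq_zero hz (by linarith) h1,
      riemannZetaZeroOrder_one_sub_conj (by linarith) h1⟩
    intro h0
    rw [h0, zero_sub, abs_neg] at him
    linarith
  -- the reflection-closed set
  set r : ℂ → ℂ := fun ρ ↦ 1 - conj ρ with hr
  have hrr : ∀ ρ, r (r ρ) = ρ := fun ρ ↦ by simp [hr]
  have hr_re : ∀ ρ, (r ρ).re = 1 - ρ.re := fun ρ ↦ by simp [hr]
  have hr_im : ∀ ρ, (r ρ).im = ρ.im := fun ρ ↦ by simp [hr]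
  have hrinj : Set.InjOn r ↑P := fun x _ y _ h ↦ by rw [← hrr x, ← hrr y, h]
  have hdisj : Disjoint P (P.image r) := by
    rw [Finset.disjoint_left]
    intro ρ hρ hρ'
    obtain ⟨ρ', hρ'P, rfl⟩ := Finset.mem_image.mp hρ'
    have := (hPf ρ' hρ'P).2.1
    have := (hPf _ hρ).2.1
    rw [hr_re] at this
    linarith
  set Pf : Finset ℂ := P ∪ P.image r with hPf_def
  have hsumPf : ∀ f : ℂ → ℝ, ∑ ρ ∈ Pf, f ρ = ∑ ρ ∈ P, f ρ + ∑ ρ ∈ P, f (r ρ) := by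
    intro f
    rw [hPf_def, Finset.sum_union hdisj, Finset.sum_image hrinj]
  have hPfz : ∀ ρ ∈ Pf, riemannZeta ρ = 0 ∧ 0 ≤ ρ.re ∧ ρ.re ≤ 1 ∧ ρ.im ≠ 0 := by
    intro ρ hρ
    rcases Finset.mem_union.mp hρ with h | h
    · obtain ⟨hz, hre, h1, him, -⟩ := hPf ρ h
      exact ⟨hz, by linarith, h1.le, him⟩
    · obtain ⟨ρ', hρ'P, rfl⟩ := Finset.mem_image.mp h
      obtain ⟨-, hre, h1, him, hz', -⟩ := hPf ρ' hρ'P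
      refine ⟨hz', ?_, ?_, ?_⟩
      · rw [hr_re]; linarith
      · rw [hr_re]; linarith
      · rwa [hr_im]
  -- completeness of `Pf` in the zone
  have hzone : ∀ ρ : ℂ, riemannZeta ρ = 0 → 0 ≤ ρ.re → ρ.re ≤ 1 → ρ.re ≠ 1 / 2 →
      |ρ.im - γ₀| < π * (J + K) → ρ ∈ Pf := by
    intro ρ hz h0 h1 hne hnear
    rcases hcomp ρ hz h0 h1 hne hnear with h | h
    · exact Finset.mem_union_left _ h
    · refine Finset.mem_union_right _ (Finset.mem_image.mpr ⟨r ρ, h, hrr ρ⟩)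
  -- the zero-sum bound and Weil positivity
  have hB := zeroSum_combPair_le (J := J) (γ₀ := γ₀) hq hK hc ha1 htA hsB hK2 Pf
    (fun ρ hρ ↦ (hPfz ρ hρ).1) hzone
  have hW := weilGroundEnergy_le_of_pairs hg hgs hpos hPfz hB
  have hnum : 0 ≤ 16 * π * A₁ * combC ^ 2 * (2 * J + 1) * L +
      ∑ ρ ∈ Pf, m ρ * ‖weilMellin g ρ‖ ^ 2 -
      (∑ ρ ∈ Pf, m ρ * ‖weilMellin g ρ - weilMellin g (1 - conj ρ)‖ ^ 2) / 2 := by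
    by_contra hx
    exact absurd (hE.trans hW) (not_le.mpr (div_neg_of_neg_of_pos (not_le.mp hx) hpos))
  -- rewrite the sums over `Pf` as sums over `P`
  rw [hsumPf, hsumPf] at hnum
  have hpair : ∀ ρ ∈ P,
      m ρ * ‖weilMellin g ρ‖ ^ 2 + m (r ρ) * ‖weilMellin g (r ρ)‖ ^ 2 -
        (m ρ * ‖weilMellin g ρ - weilMellin g (1 - conj ρ)‖ ^ 2 +
          m (r ρ) * ‖weilMellin g (r ρ) - weilMellin g (1 - conj (r ρ))‖ ^ 2) / 2 =
      2 * m ρ * (weilMellin g ρ * conj (weilMellin g (1 - conj ρ))).re := by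
    intro ρ hρ
    have hmr : m (r ρ) = m ρ := by simp only [hm, hr]; exact_mod_cast (hPf ρ hρ).2.2.2.2.2
    have hrr' : 1 - conj (r ρ) = ρ := hrr ρ
    rw [hmr, hrr', show (1 - conj ρ : ℂ) = r ρ from rfl, norm_sub_rev (weilMellin g (r ρ))]
    linear_combination (m ρ) * norm_sq_add_norm_sq_sub_norm_sq_sub (weilMellin g ρ)
      (weilMellin g (r ρ))
  have hsum_pair : ∑ ρ ∈ P, m ρ * ‖weilMellin g ρ‖ ^ 2 +
      ∑ ρ ∈ P, m (r ρ) * ‖weilMellin g (r ρ)‖ ^ 2 -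
      (∑ ρ ∈ P, m ρ * ‖weilMellin g ρ - weilMellin g (1 - conj ρ)‖ ^ 2 +
        ∑ ρ ∈ P, m (r ρ) * ‖weilMellin g (r ρ) - weilMellin g (1 - conj (r ρ))‖ ^ 2) / 2 =
      ∑ ρ ∈ P, 2 * m ρ * (weilMellin g ρ * conj (weilMellin g (1 - conj ρ))).re := by
    rw [← Finset.sum_congr rfl hpair, Finset.sum_sub_distrib, Finset.sum_add_distrib,
      ← Finset.sum_div, Finset.sum_add_distrib]
  -- the net pair identity, termwise
  have hterm : ∀ ρ ∈ P, 2 * m ρ * (weilMellin g ρ * conj (weilMellin g (1 - conj ρ))).re ≤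
      6 * (m ρ * ‖Φ ρ‖ ^ 2) + 2 * (conj c * ((m ρ : ℂ) * (Φ ρ ^ 2 * cexp (Λ ρ * τ)))).re := by
    intro ρ hρ
    have hm0 : 0 ≤ m ρ := riemannZetaZeroOrder_nonneg_of_zero (hPf ρ hρ).1
    have hid := weilMellin_combPair_mul_conj (J := J) (c := c) (tA := tA) (sB := sB) (γ₀ := γ₀) ρ
    have hτeq' : ((tA : ℂ) - (sB : ℂ)) = (τ : ℂ) := by rw [← Complex.ofReal_sub, hτeq]
    rw [hτeq'] at hid
    rw [hid]
    have hxpos : 0 < (Λ ρ).re := by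
      simp only [hΛ, sub_re, Complex.mul_re, Complex.I_re, Complex.I_im, Complex.ofReal_re,
        Complex.ofReal_im]
      norm_num
      linarith [(hPf ρ hρ).2.1]
    -- sizes
    have hΦ2 : ‖Φ ρ ^ 2‖ = ‖Φ ρ‖ ^ 2 := norm_pow _ 2
    have he1 : ‖cexp (-(Λ ρ * τ))‖ ≤ 1 := by
      rw [Complex.norm_exp, neg_re, Real.exp_le_one_iff, neg_nonpos]
      have : (Λ ρ * τ).re = (Λ ρ).re * τ := by simp [Complex.mul_re]
      rw [this]; exact mul_nonneg hxpos.le (by linarith)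
    have hc1 : ‖c‖ ^ 2 ≤ 1 := by nlinarith [hc, norm_nonneg c]
    have hA : ((Φ ρ) ^ 2 * (((1 + ‖c‖ ^ 2 : ℝ) : ℂ))).re ≤ 2 * ‖Φ ρ‖ ^ 2 := by
      refine (Complex.re_le_norm _).trans ?_
      rw [norm_mul, hΦ2, Complex.norm_real, Real.norm_eq_abs, abs_of_nonneg (by positivity)]
      have := mul_le_mul_of_nonneg_left hc1 (sq_nonneg ‖Φ ρ‖)
      linarith
    have hCterm : ((Φ ρ) ^ 2 * (c * cexp (-(Λ ρ * τ)))).re ≤ ‖Φ ρ‖ ^ 2 := by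
      refine (Complex.re_le_norm _).trans ?_
      rw [norm_mul, norm_mul, hΦ2]
      have hce : ‖c‖ * ‖cexp (-(Λ ρ * τ))‖ ≤ 1 := by
        calc ‖c‖ * ‖cexp (-(Λ ρ * τ))‖ ≤ 1 * 1 := mul_le_mul hc he1 (norm_nonneg _) zero_le_one
          _ = 1 := one_mul 1
      exact mul_le_of_le_one_right (sq_nonneg _) hce
    have hBterm : ((Φ ρ) ^ 2 * (conj c * cexp (Λ ρ * τ))).re =
        (conj c * ((m ρ : ℂ) * (Φ ρ ^ 2 * cexp (Λ ρ * τ)))).re / m ρ ∨ m ρ = 0 := by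
      rcases eq_or_ne (m ρ) 0 with h0 | h0
      · exact Or.inr h0
      · left
        have : conj c * ((m ρ : ℂ) * (Φ ρ ^ 2 * cexp (Λ ρ * τ))) =
            (m ρ : ℂ) * ((Φ ρ) ^ 2 * (conj c * cexp (Λ ρ * τ))) := by ring
        rw [this, Complex.re_ofReal_mul, mul_div_cancel_left₀ _ h0]
    have hsplit : ((Φ ρ) ^ 2 * ((((1 + ‖c‖ ^ 2 : ℝ) : ℂ)) + conj c * cexp (Λ ρ * τ) +
        c * cexp (-(Λ ρ * τ)))).re =
        ((Φ ρ) ^ 2 * (((1 + ‖c‖ ^ 2 : ℝ) : ℂ))).re + ((Φ ρ) ^ 2 * (conj c * cexp (Λ ρ * τ))).re +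
          ((Φ ρ) ^ 2 * (c * cexp (-(Λ ρ * τ)))).re := by
      simp only [mul_add, Complex.add_re]
    rw [hsplit]
    have hA' := mul_le_mul_of_nonneg_left hA hm0
    have hC' := mul_le_mul_of_nonneg_left hCterm hm0
    rcases hBterm with hB' | h0
    · rw [hB']
      have : 2 * m ρ * ((conj c * ((m ρ : ℂ) * (Φ ρ ^ 2 * cexp (Λ ρ * τ)))).re / m ρ) =
          2 * (conj c * ((m ρ : ℂ) * (Φ ρ ^ 2 * cexp (Λ ρ * τ)))).re := by
        rcases eq_or_ne (m ρ) 0 with h0 | h0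
        · rw [h0]; simp
        · field_simp
      linarith
    · have : (conj c * ((m ρ : ℂ) * (Φ ρ ^ 2 * cexp (Λ ρ * τ)))).re = 0 := by
        rw [h0]; simp
      rw [this, h0]; simp
  have hre_sum : ∑ ρ ∈ P, 2 * (conj c * ((m ρ : ℂ) * (Φ ρ ^ 2 * cexp (Λ ρ * τ)))).re =
      2 * (conj c * U).re := by
    rw [hU, Finset.mul_sum, Complex.re_sum, Finset.mul_sum]
  have hcU : (conj c * U).re = -‖U‖ := re_conj_phase_mul U
  have hle := Finset.sum_le_sum hterm
  rw [Finset.sum_add_distrib, hre_sum, hcU, ← Finset.mul_sum] at hle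
  -- the size of `S`
  have hS : Sq ≤ 4 * π * A₁ * combC ^ 2 * (2 * J + 1) * L :=
    sum_norm_sq_combXform_le γ₀ J P fun ρ hρ ↦
      ⟨(hPf ρ hρ).1, by linarith [(hPf ρ hρ).2.1], (hPf ρ hρ).2.2.1.le, (hPf ρ hρ).2.2.2.1⟩
  have h2U : 2 * ‖U‖ ≤ 16 * π * A₁ * combC ^ 2 * (2 * J + 1) * L + 6 * Sq := by
    rw [hSq]; linarith [hnum, hsum_pair, hle]
  linarith

end Summit.RiemannHypothesis.RiemannHypothesis.Theorems
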